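import Summits.Ventures.PercRepro.C041TriDomGlueSideB

/-!
# ROW C-041 — GLUING AT A CUT VERTEX, III: THE CLASSES ON A STATUS, THE SIBLING DOMINATION, AND THE FIBRES
(p6, gen 45; P6-TWOEXIT-LEAN.md §53 ADDENDUM 16)

* CONJECTURE (STOCHASTIC DOMINATION) on an arbitrary STATUS (`CycCrossedS`, `TopBotS`, `CycDominationS`; the all-free
  status is the landed `CycCrossed` / `TopBot` / `CycDomination`, definitionally), with the unfolded forms of the
  classes in the twelve connectivities (`cycCrossedS_iff`, `topBotS_iff`).
* THE SIBLING DOMINATION (`SibDominationS`) of a host with marks `x, y` and a TERMINAL `v`: on every up-set,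
  `#{x ~_R y, x ≁_B y, x ~_B v, y ≁_B v} + #{y ~_R v, y ≁_R x, x ≁_R v, x ~_B y} ≤ #{x ~_R y ~_R v, x ≁_B y}`
  (in pair-type patterns `(xy, xv, yv)`: `(R,B,N) + (R,D,R) + (B,N,R) + (B,B,D) ≤ (R,R,R) + (R,R,D) + (R,D,R)`).
  It is the conjecture on the host with a PENDANT EDGE at `v` (`C041TriDomGluePendant`), and it is what the gluing
  at a cut vertex needs beside the conjecture itself.
* THE FIBRES (`cycCrossed_merge_iff`, `topBot_merge_iff`): for a cut vertex `v` with the marks `x, y` off the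
  `z`-side, a colouring `merge o i` (outside part `o`, inside part `i`) is crossed / `(⊤, ⊥)` according to the
  `(v, z)`-type of `i` under `stIn` — `D` (both colours: the classes of `(x, y, v)` under `stOut`), `R` (red only:
  the sibling's second class / target), `B` (blue only: the sibling's first class / nothing) — exactly the
  decomposition of ADDENDUM 16.
-/

namespace PercRepro

namespace ZoneZ

namespace MultiExit

open ZoneData Finset GlueB

variable {V₁ E₁ U₁ U₂ : Type} (Z₁ : ZoneData V₁ E₁ U₁ U₂) (x y z : V₁)

/-! ## The patterns of a status, unfolded -/

open Classical in
/-- A red pattern under a status equals a Boolean triple iff the three connectivities decide to it. -/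
theorem rsigS_eq_iff (st : E₁ → EStat) (ω : E₁ → Bool) (b₁ b₂ b₃ : Bool) :
    rsig Z₁ y z x st ω = (b₁, b₂, b₃) ↔
      (RdS Z₁ st ω x y ↔ b₁ = true) ∧ (RdS Z₁ st ω x z ↔ b₂ = true) ∧ (RdS Z₁ st ω y z ↔ b₃ = true) := by
  unfold rsig
  simp only [Prod.mk.injEq]
  constructor
  · rintro ⟨h1, h2, h3⟩
    refine ⟨?_, ?_, ?_⟩
    · rw [← h1]; exact (decide_eq_true_iff).symm
    · rw [← h2]; exact (decide_eq_true_iff).symm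
    · rw [← h3]; exact (decide_eq_true_iff).symm
  · rintro ⟨h1, h2, h3⟩
    refine ⟨?_, ?_, ?_⟩
    · exact decide_eq_of_iff h1
    · exact decide_eq_of_iff h2
    · exact decide_eq_of_iff h3

open Classical in
/-- A blue pattern under a status equals a Boolean triple iff the three connectivities decide to it. -/
theorem bsigS_eq_iff (st : E₁ → EStat) (ω : E₁ → Bool) (b₁ b₂ b₃ : Bool) :
    bsig Z₁ y z x st ω = (b₁, b₂, b₃) ↔
      (MgS Z₁ st ω x y ↔ b₁ = true) ∧ (MgS Z₁ st ω x z ↔ b₂ = true) ∧ (MgS Z₁ st ω y z ↔ b₃ = true) := by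
  unfold bsig
  simp only [Prod.mk.injEq]
  constructor
  · rintro ⟨h1, h2, h3⟩
    refine ⟨?_, ?_, ?_⟩
    · rw [← h1]; exact (decide_eq_true_iff).symm
    · rw [← h2]; exact (decide_eq_true_iff).symm
    · rw [← h3]; exact (decide_eq_true_iff).symm
  · rintro ⟨h1, h2, h3⟩
    refine ⟨?_, ?_, ?_⟩
    · exact decide_eq_of_iff h1
    · exact decide_eq_of_iff h2
    · exact decide_eq_of_iff h3

/-! ## The conjecture on a status -/

/-- The cyclic crossed classes `(s₁,s₂) ∪ (s₂,s₃) ∪ (s₃,s₁)` of the host under a status (anchor `x`, exits `y, z`). -/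
def CycCrossedS (st : E₁ → EStat) (ω : E₁ → Bool) : Prop :=
  (rsig Z₁ y z x st ω = (true, false, false) ∧ bsig Z₁ y z x st ω = (false, true, false)) ∨
    (rsig Z₁ y z x st ω = (false, true, false) ∧ bsig Z₁ y z x st ω = (false, false, true)) ∨
    (rsig Z₁ y z x st ω = (false, false, true) ∧ bsig Z₁ y z x st ω = (true, false, false))

/-- The class `(⊤, ⊥)` of the host under a status. -/
def TopBotS (st : E₁ → EStat) (ω : E₁ → Bool) : Prop :=
  rsig Z₁ y z x st ω = (true, true, true) ∧ bsig Z₁ y z x st ω = (false, false, false)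

/-- The crossed classes of the all-free status are the landed ones. -/
theorem cycCrossedS_free : CycCrossedS Z₁ x y z (fun _ => EStat.free) = CycCrossed Z₁ x y z := rfl

/-- The class `(⊤, ⊥)` of the all-free status is the landed one. -/
theorem topBotS_free : TopBotS Z₁ x y z (fun _ => EStat.free) = TopBot Z₁ x y z := rfl

/-- The crossed classes under a status, in the twelve connectivities. -/
theorem cycCrossedS_iff (st : E₁ → EStat) (ω : E₁ → Bool) : CycCrossedS Z₁ x y z st ω ↔
    ((RdS Z₁ st ω x y ∧ ¬ RdS Z₁ st ω x z ∧ ¬ RdS Z₁ st ω y z) ∧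
        (¬ MgS Z₁ st ω x y ∧ MgS Z₁ st ω x z ∧ ¬ MgS Z₁ st ω y z)) ∨
      ((¬ RdS Z₁ st ω x y ∧ RdS Z₁ st ω x z ∧ ¬ RdS Z₁ st ω y z) ∧
        (¬ MgS Z₁ st ω x y ∧ ¬ MgS Z₁ st ω x z ∧ MgS Z₁ st ω y z)) ∨
      ((¬ RdS Z₁ st ω x y ∧ ¬ RdS Z₁ st ω x z ∧ RdS Z₁ st ω y z) ∧
        (MgS Z₁ st ω x y ∧ ¬ MgS Z₁ st ω x z ∧ ¬ MgS Z₁ st ω y z)) := by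
  unfold CycCrossedS
  simp only [rsigS_eq_iff, bsigS_eq_iff, iff_true, Bool.false_eq_true, iff_false]

/-- The class `(⊤, ⊥)` under a status, in the six connectivities. -/
theorem topBotS_iff (st : E₁ → EStat) (ω : E₁ → Bool) : TopBotS Z₁ x y z st ω ↔
    (RdS Z₁ st ω x y ∧ RdS Z₁ st ω x z ∧ RdS Z₁ st ω y z) ∧
      (¬ MgS Z₁ st ω x y ∧ ¬ MgS Z₁ st ω x z ∧ ¬ MgS Z₁ st ω y z) := by
  unfold TopBotS
  simp only [rsigS_eq_iff, bsigS_eq_iff, iff_true, Bool.false_eq_true, iff_false]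

section Counting

variable [Fintype E₁] [DecidableEq E₁]

open Classical in
/-- CONJECTURE (STOCHASTIC DOMINATION) on a status: on every up-set the crossed classes are outnumbered by `(⊤, ⊥)`. -/
def CycDominationS (st : E₁ → EStat) : Prop :=
  ∀ V : (E₁ → Bool) → Prop, UpSet V →
    (univ.filter fun ω : E₁ → Bool => V ω ∧ CycCrossedS Z₁ x y z st ω).card ≤
      (univ.filter fun ω : E₁ → Bool => V ω ∧ TopBotS Z₁ x y z st ω).card

/-- On the all-free status the status form is the landed conjecture. -/
theorem cycDominationS_free : CycDominationS Z₁ x y z (fun _ => EStat.free) ↔ CycDomination Z₁ x y z := Iff.rfl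

end Counting

/-! ## The sibling domination -/

/-- The sibling's first class `{x ~_R y, x ≁_B y, x ~_B v, y ≁_B v}` (patterns `(R,B,N)`, `(R,D,R)` on `(xy, xv, yv)`). -/
def SibC₁ (v : V₁) (st : E₁ → EStat) (ω : E₁ → Bool) : Prop :=
  RdS Z₁ st ω x y ∧ ¬ MgS Z₁ st ω x y ∧ MgS Z₁ st ω x v ∧ ¬ MgS Z₁ st ω y v

/-- The sibling's second class `{y ~_R v, y ≁_R x, x ≁_R v, x ~_B y}` (patterns `(B,N,R)`, `(B,B,D)`). -/
def SibC₃ (v : V₁) (st : E₁ → EStat) (ω : E₁ → Bool) : Prop :=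
  RdS Z₁ st ω y v ∧ ¬ RdS Z₁ st ω x y ∧ ¬ RdS Z₁ st ω x v ∧ MgS Z₁ st ω x y

/-- The sibling's target `{x ~_R y ~_R v, x ≁_B y}` (patterns `(R,R,R)`, `(R,R,D)`, `(R,D,R)`). -/
def SibTop (v : V₁) (st : E₁ → EStat) (ω : E₁ → Bool) : Prop :=
  RdS Z₁ st ω x y ∧ RdS Z₁ st ω x v ∧ RdS Z₁ st ω y v ∧ ¬ MgS Z₁ st ω x y

section Sibling

variable [Fintype E₁] [DecidableEq E₁]

open Classical in
/-- **THE SIBLING DOMINATION** of the marks `x, y` and the terminal `v`: on every up-set the two sibling classes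
together are outnumbered by the sibling target.  (A conjecture of the lane, census-true on all 1,096 labelled simple
graphs on `≤ 5` vertices and 150 random multigraphs — by ADDENDUM 16 it is the conjecture on the host with a
pendant edge at `v`.) -/
def SibDominationS (v : V₁) (st : E₁ → EStat) : Prop :=
  ∀ V : (E₁ → Bool) → Prop, UpSet V →
    (univ.filter fun ω : E₁ → Bool => V ω ∧ (SibC₁ Z₁ x y v st ω ∨ SibC₃ Z₁ x y v st ω)).card ≤
      (univ.filter fun ω : E₁ → Bool => V ω ∧ SibTop Z₁ x y v st ω).card

end Sibling

/-! ## The fibres over the inside part -/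

variable (v : V₁)

/-- The inside part is of type `D`: `v, z` connected in both colours on the `z`-side. -/
def tDin (i : E₁ → Bool) : Prop := RdS Z₁ (stIn Z₁ v z) i v z ∧ MgS Z₁ (stIn Z₁ v z) i v z

/-- The inside part is of type `R`: `v, z` red-connected only. -/
def tRin (i : E₁ → Bool) : Prop := RdS Z₁ (stIn Z₁ v z) i v z ∧ ¬ MgS Z₁ (stIn Z₁ v z) i v z

/-- The inside part is of type `B`: `v, z` blue-connected only. -/
def tBin (i : E₁ → Bool) : Prop := ¬ RdS Z₁ (stIn Z₁ v z) i v z ∧ MgS Z₁ (stIn Z₁ v z) i v z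

section Fibres

open Classical in
/-- **THE CROSSED FIBRES**: a merged colouring is crossed according to the type of its inside part. -/
theorem cycCrossed_merge_iff (hz : z ≠ v) (hx : x ∉ side Z₁ (fun _ => EStat.free) v z)
    (hy : y ∉ side Z₁ (fun _ => EStat.free) v z) (o i : E₁ → Bool) :
    CycCrossed Z₁ x y z (merge (InC Z₁ v z) o i) ↔
      (tDin Z₁ z v i ∧ CycCrossedS Z₁ x y v (stOut Z₁ v z) o) ∨
        (tRin Z₁ z v i ∧ SibC₃ Z₁ x y v (stOut Z₁ v z) o) ∨
        (tBin Z₁ z v i ∧ SibC₁ Z₁ x y v (stOut Z₁ v z) o) := by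
  have hzC : z ∈ side Z₁ (fun _ => EStat.free) v z := mem_reach_self _ _
  have hv : v ∉ side Z₁ (fun _ => EStat.free) v z := v_not_mem_side Z₁ v z hz
  rw [← cycCrossedS_free, cycCrossedS_iff, cycCrossedS_iff]
  unfold SibC₁ SibC₃ tDin tRin tBin
  rw [RdS_free_iff_out Z₁ v z hz _ hx hy, RdS_free_iff_through Z₁ v z hz _ hx hzC,
    RdS_free_iff_through Z₁ v z hz _ hy hzC, MgS_free_iff_out Z₁ v z hz _ hx hy,
    MgS_free_iff_through Z₁ v z hz _ hx hzC, MgS_free_iff_through Z₁ v z hz _ hy hzC,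
    RdS_stOut_merge, RdS_stOut_merge, RdS_stOut_merge, RdS_stIn_merge, MgS_stOut_merge, MgS_stOut_merge,
    MgS_stOut_merge, MgS_stIn_merge]
  by_cases hR : RdS Z₁ (stIn Z₁ v z) i v z <;> by_cases hB : MgS Z₁ (stIn Z₁ v z) i v z
  all_goals
    simp only [hR, hB, and_true, and_false, not_true_eq_false, not_false_eq_true, true_and, false_and, or_false,
      false_or]
  all_goals tauto

open Classical in
/-- **THE `(⊤, ⊥)` FIBRES**: a merged colouring is `(⊤, ⊥)` according to the type of its inside part. -/
theorem topBot_merge_iff (hz : z ≠ v) (hx : x ∉ side Z₁ (fun _ => EStat.free) v z)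
    (hy : y ∉ side Z₁ (fun _ => EStat.free) v z) (o i : E₁ → Bool) :
    TopBot Z₁ x y z (merge (InC Z₁ v z) o i) ↔
      (tDin Z₁ z v i ∧ TopBotS Z₁ x y v (stOut Z₁ v z) o) ∨ (tRin Z₁ z v i ∧ SibTop Z₁ x y v (stOut Z₁ v z) o) := by
  have hzC : z ∈ side Z₁ (fun _ => EStat.free) v z := mem_reach_self _ _
  have hv : v ∉ side Z₁ (fun _ => EStat.free) v z := v_not_mem_side Z₁ v z hz
  rw [← topBotS_free, topBotS_iff, topBotS_iff]
  unfold SibTop tDin tRin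
  rw [RdS_free_iff_out Z₁ v z hz _ hx hy, RdS_free_iff_through Z₁ v z hz _ hx hzC,
    RdS_free_iff_through Z₁ v z hz _ hy hzC, MgS_free_iff_out Z₁ v z hz _ hx hy,
    MgS_free_iff_through Z₁ v z hz _ hx hzC, MgS_free_iff_through Z₁ v z hz _ hy hzC,
    RdS_stOut_merge, RdS_stOut_merge, RdS_stOut_merge, RdS_stIn_merge, MgS_stOut_merge, MgS_stOut_merge,
    MgS_stOut_merge, MgS_stIn_merge]
  by_cases hR : RdS Z₁ (stIn Z₁ v z) i v z <;> by_cases hB : MgS Z₁ (stIn Z₁ v z) i v z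
  all_goals
    simp only [hR, hB, and_true, and_false, not_true_eq_false, not_false_eq_true, true_and, false_and, or_false,
      false_or]
  all_goals tauto

end Fibres

end MultiExit

end ZoneZ

end PercRepro
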